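import Summits.QuantumFields.BalabanUV.Beta.GAN24.AveragedPropagatorTowerDecayCubic
import Summits.QuantumFields.BalabanUV.Beta.GAN24.AveragedPropagatorInverseDecayCubic

/-!
# G-an2-4 ∕ (CONV-C), road P2, VECTOR LAYER — THE TOWER OF THE INVERSES `k ↦ (c_{L^k}(1))⁻¹ = (Q_{L^k}𝒢Q_{L^k}*)⁻¹` (the `H_k` denominator ∕
# NE2's `Δ_K^{(k)} + 1`) IN THE ROW's KERNEL CURRENCY ON CUBIC UNIT TORI, `U = 1`, `a = 1`: k-UNIFORM DECAY, GEOMETRIC ONE-STEP RATE `θ = L^{−1∕2}`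
# WITH DECAY, THE ENTRYWISE LIMIT `d_∞` WITH LOCALISATION, AND THE SAME TWO CLAUSES FOR `Δ_K^{(k)}` — UNCONDITIONAL

G-an2-4 formalisation swarm `b2b-balaban-gan24-formalise-*`, leaf prover 06 (gen 37), crux team (2) under the coordinator ruling «YM REDIRECT»
(e34b3e0c; FREEZE (0) honoured — a `GAN24/` corollary importing EXISTING modules only; filed on the road-P2 chair `b2b-balaban-gan24-p2` (gen 30)'s
OPEN INVITATION «VECTOR-TOWER-KERNEL» (HOME/INBOX.md 2026-08-21T12:4xZ: «the tower packaging N = L^k, R = L of Parts 10∕11 into the literal two-clause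
shape … (and the same for `(c_n)⁻¹`, `Δ_K`), à la leaf-06's `ScalarUnitLatticeTower` … say INTENT, I will not file it»); the direct tower `k ↦ c_{L^k}`
is this lineage's `AveragedPropagatorTowerDecayCubic`; this is the companion for the inverses — the KERNEL-currency twin of leaf-04 (gen 50)'s
sup-currency `AveragedPropagatorInverseTowerCubic`).
INPUTS, BY NAME and nothing else estimated: the chair's Part 11 `AveragedPropagatorInverseDecayCubic.norm_covOp_inv_succ_sub_apply_le_cubic`
(`∃ K δ₄ > 0, ∀ N R N₀ ≥ 1, ∀ i i′, ‖((c_{RN})⁻¹ − (c_N)⁻¹)(i,i′)‖ ≤ K·((R−1)∕(RN))·(2 + log(RN) + log N)·e^{−δ₄|rep i₁ − rep i′₁|_T}`) and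
`covOp_inv_kernel_decay_cubic` (leaf-03's explicit-inverse kernel bound re-read), `AveragedPropagatorInverseOneStep.DeltaK_succ_sub_eq` and
`BalabanHardMinimizer.DeltaK` (NE2), and the §0 packaging lemmas of `AveragedPropagatorTowerDecayCubic` (`norm_tower_step_le_of_twoLevel`,
`norm_tower_step_le_geometric`, `exists_tower_limit`, `level_congr`).  THIS FILE:
 * §1 **`convC_shape_covOp_inv_tower_decay_cubic`** — `∃ δ₅ > 0` (d), `∀ L ≥ 2 ∃ C₄ > 0` (d, L), `∀ N₀ k i i′`: `‖(c_{L^k})⁻¹(i,i′)‖ ≤ C₄e^{−δ₅|…|}` ∧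
   `‖((c_{L^{k+1}})⁻¹ − (c_{L^k})⁻¹)(i,i′)‖ ≤ C₄(1∕√L)^k e^{−δ₅|…|}`; **`tendsto_covOp_inv_tower_decay_cubic`** — `∀ L ≥ 2 ∃ C₅ ∀ N₀ ∃ d_∞ ∀ i i′`:
   entrywise convergence, `‖((c_{L^k})⁻¹ − d_∞)(i,i′)‖ ≤ C₅(1∕√L)^k e^{−δ₅|…|}`, `‖d_∞(i,i′)‖ ≤ C₅e^{−δ₅|…|}`, `C₅ = 2C₄∕(1 − 1∕√L)`.
 * §2 **`convC_shape_DeltaK_tower_decay_cubic`** — the same two clauses for NE2's `Δ_K^{(L^k)} = (c_{L^k})⁻¹ − 1`: the differences are the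
   inverse's (`DeltaK_succ_sub_eq`), the kernel of `Δ_K` is the inverse's minus the identity's (`‖Δ_K(i,i′)‖ ≤ (C₄ + 1)·e^{−δ₅|…|}` since the
   diagonal has distance `0`).  The statement displays `DeltaK (L^k) hk T 1 one_pos` with the level witnesses `hk : 1 ≤ L^k` as binders (the
   chair's Part 7∕11 convention); NE2's tower object `BalabanHardMinimizer.DeltaKlev L T 1 one_pos k = DeltaK (lev L k) (one_le_lev' L k) …`
   (`DeltaKlev_eq`) is reached through `lev L k = L^k` (`VariationalDelKBridge.lev_eq_pow`) and `DeltaK_level_congr` below.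
WHAT IS ALREADY IN THE TREE (NE2 lane, credited): the EXISTENCE of these limits with an ℓ²-OPERATOR-NORM rate `L^{−k}` on every torus and every `a`
(`BalabanAveragedCoerciveTower.covBlev_tendsto`, `BalabanHardMinimizer.DeltaKlev_tendsto`); by uniqueness of limits `d_∞` IS that `cinf⁻¹` entrywise,
and leaf-04's sup-currency `d_∞ = c_∞⁻¹`.  What THIS file adds is the KERNEL currency: exponential localisation, uniformly in `N₀`.
HONEST SCOPE.  [folklore] junction BY NAME (one `obtain` per input + §0's real analysis); `U = 1`, `a = 1`, CUBIC unit tori in dimension `d + 1` (Part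
11's restriction, i.e. the second-order `(1 + log n)` letters'), the unit-lattice-read constituent only, constants EXISTENTIAL; the identification
`Δ_K = Δ_k` of [B5] (1.65) is NE2's open dictionary step and is NOT claimed; limits NAMED on the fixed finite carrier, not identified with any continuum
or Bałaban kernel (R213-2).  [Balaban1984PropagatorsI] (1.65), (1.99), [Balaban1984PropagatorsII] (2.35) are TEXT LOCATIONS.  NOT (CONV-C) as typed,
NEVER «G-an2-4 closed», NOT NE2 ∕ NE3, NOT D1, NOT BetaPertH, NOT continuum, NOT Clay; 0 def, 0 `def … : Prop`, 0 cite tag, no sorry — not in print,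
our bookkeeping.  HONEST DEPENDENCY: continuum YM on T⁴ ⇐ BetaPertH ∧ nine spine estimates (0/9 proved); BetaPertH ⇐ (D1) ∧ (D4) ∧ CAP+tail; G-an2-4
gates asym, D1 and NE2/3/4.
-/

noncomputable section

open scoped BigOperators ComplexConjugate Matrix

namespace Summit.QuantumFields.BalabanUV.Beta.GAN24.AveragedPropagatorInverseTowerDecayCubic

open Filter
open Literature.MathematicalPhysics.QuantumFieldTheory.Balaban1983to89
open B5Prop11Plancherel (Tor)
open B6LowerBound2153Torus (rep)
open B4TorusKernel.MultiPeriod (torusSupNorm)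
open Summit.QuantumFields.BalabanUV.T4Continuum.BalabanHardMinimizer (DeltaK)
open Summit.QuantumFields.BalabanUV.Beta.GAN24.AveragedPropagatorTwoLevel (covOp)
open Summit.QuantumFields.BalabanUV.Beta.GAN24.AveragedPropagatorOneStepCubic (covOp_eq_covB)
open Summit.QuantumFields.BalabanUV.Beta.GAN24.AveragedPropagatorInverseOneStep (DeltaK_succ_sub_eq)
open Summit.QuantumFields.BalabanUV.Beta.GAN24.BlockFieldDecay (tsn_self)
open Summit.QuantumFields.BalabanUV.Beta.GAN24.AveragedPropagatorInverseDecayCubic (norm_covOp_inv_succ_sub_apply_le_cubic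
  covOp_inv_kernel_decay_cubic)
open Summit.QuantumFields.BalabanUV.Beta.GAN24.AveragedPropagatorTowerDecayCubic (level_congr norm_tower_step_le_of_twoLevel
  norm_tower_step_le_geometric exists_tower_limit)

variable (d : ℕ)

/-! ## §1 The tower `k ↦ (c_{L^k}(1))⁻¹` in kernel currency -/

/-- **THE (CONV-C) TWO-CLAUSE SHAPE FOR THE INVERSE `(Q_k𝒢_kQ_k*)⁻¹` IN KERNEL CURRENCY ON CUBIC UNIT TORI — UNCONDITIONAL**: `∃ δ₅ > 0` (d),
`∀ L ≥ 2 ∃ C₄ > 0` (d, L), `∀ N₀ ≥ 1 ∀ k i i′`: `‖(c_{L^k})⁻¹(i,i′)‖ ≤ C₄·e^{−δ₅|rep i₁ − rep i′₁|_T}` (the chair's `covOp_inv_kernel_decay_cubic` =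
leaf-03's explicit-inverse kernel bound, k-uniform) ∧ `‖((c_{L^{k+1}})⁻¹ − (c_{L^k})⁻¹)(i,i′)‖ ≤ C₄·(1∕√L)^k·e^{−δ₅|rep i₁ − rep i′₁|_T}` (the chair's Part 11 along `N = L^k`,
`R = L`, packaged by `AveragedPropagatorTowerDecayCubic` §0). [folklore] -/
theorem convC_shape_covOp_inv_tower_decay_cubic :
    ∃ δ₅ : ℝ, 0 < δ₅ ∧ ∀ (L : ℕ) [NeZero L], 2 ≤ L → ∃ C₄ : ℝ, 0 < C₄ ∧
      ∀ (N₀ : ℕ) [NeZero N₀] (k : ℕ) (i i' : Tor (fun _ : Fin (d + 1) => N₀) × Fin (d + 1)),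
        ‖(covOp (L ^ k) (fun _ : Fin (d + 1) => N₀) 1)⁻¹ i i'‖
            ≤ C₄ * Real.exp (-(δ₅ * torusSupNorm (fun _ : Fin (d + 1) => N₀)
                (rep (fun _ : Fin (d + 1) => N₀) i.1 - rep (fun _ : Fin (d + 1) => N₀) i'.1))) ∧
        ‖((covOp (L ^ (k + 1)) (fun _ : Fin (d + 1) => N₀) 1)⁻¹ - (covOp (L ^ k) (fun _ : Fin (d + 1) => N₀) 1)⁻¹) i i'‖
            ≤ C₄ * ((Real.sqrt L)⁻¹) ^ k * Real.exp (-(δ₅ * torusSupNorm (fun _ : Fin (d + 1) => N₀)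
                (rep (fun _ : Fin (d + 1) => N₀) i.1 - rep (fun _ : Fin (d + 1) => N₀) i'.1))) := by
  obtain ⟨K₀, δ₀, hK₀, hδ₀, h0⟩ := covOp_inv_kernel_decay_cubic d
  obtain ⟨K, δ', hK, hδ', h1⟩ := norm_covOp_inv_succ_sub_apply_le_cubic d
  refine ⟨min δ₀ δ', lt_min hδ₀ hδ', fun L _ hL2 => ?_⟩
  have hL1 : (1 : ℝ) < L := by exact_mod_cast hL2
  have hlog : 0 ≤ Real.log (L : ℝ) := Real.log_nonneg hL1.le
  have hsq : 1 < Real.sqrt L := by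
    rw [show (1 : ℝ) = Real.sqrt 1 from Real.sqrt_one.symm]
    exact Real.sqrt_lt_sqrt zero_le_one hL1
  have hy1 : (Real.sqrt L)⁻¹ < 1 := inv_lt_one_of_one_lt₀ hsq
  have h1y : 0 < 1 - (Real.sqrt L)⁻¹ := by linarith
  set B : ℝ := 2 * K * (1 + Real.log (L : ℝ)) with hB
  have hB0 : 0 ≤ B := by positivity
  set C₄ : ℝ := max K₀ (B / (1 - (Real.sqrt L)⁻¹)) with hC₄
  have hC₄pos : 0 < C₄ := lt_max_of_lt_left hK₀
  refine ⟨C₄, hC₄pos, fun N₀ _ k i i' => ?_⟩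
  set t := torusSupNorm (fun _ : Fin (d + 1) => N₀) (rep (fun _ : Fin (d + 1) => N₀) i.1 - rep (fun _ : Fin (d + 1) => N₀) i'.1)
  have ht : 0 ≤ t :=
    B4TorusKernel.MultiPeriod.torusSupNorm_nonneg (fun _ => Nat.one_le_iff_ne_zero.mpr (NeZero.ne N₀)) _
  have hE0 : Real.exp (-(δ₀ * t)) ≤ Real.exp (-(min δ₀ δ' * t)) :=
    Real.exp_le_exp.mpr (by nlinarith [min_le_left δ₀ δ'])
  have hE' : Real.exp (-(δ' * t)) ≤ Real.exp (-(min δ₀ δ' * t)) :=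
    Real.exp_le_exp.mpr (by nlinarith [min_le_right δ₀ δ'])
  refine ⟨(h0 (L ^ k) N₀ i i').trans (mul_le_mul (le_max_left _ _) hE0 (Real.exp_pos _).le hC₄pos.le), ?_⟩
  -- clause 2: the tower step of the entry family `n ↦ (c_n)⁻¹(i, i′)` through §0 of the direct tower file
  have hstep0 := fun k : ℕ => norm_tower_step_le_of_twoLevel (E := ℂ)
    (fun n _ => (covOp n (fun _ : Fin (d + 1) => N₀) 1)⁻¹ i i') hK.le (Real.exp_pos (-(δ' * t))).le
    (fun N R _ _ => by
      have h := h1 N R N₀ i i'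
      rwa [Matrix.sub_apply] at h) L k
  have hstep : ∀ k : ℕ, ‖(covOp (L ^ (k + 1)) (fun _ : Fin (d + 1) => N₀) 1)⁻¹ i i' - (covOp (L ^ k) (fun _ : Fin (d + 1) => N₀) 1)⁻¹ i i'‖
      ≤ B * ((k : ℝ) + 1) / (L : ℝ) ^ k * Real.exp (-(δ' * t)) := fun k => by
    calc _ ≤ _ := hstep0 k
      _ = _ := by rw [hB]
  have hgeo := norm_tower_step_le_geometric (E := ℂ) (fun n _ => (covOp n (fun _ : Fin (d + 1) => N₀) 1)⁻¹ i i') hB0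
    (Real.exp_pos _).le L hL2 hstep k
  rw [Matrix.sub_apply]
  refine hgeo.trans ?_
  have hθk : 0 ≤ ((Real.sqrt L)⁻¹) ^ k := pow_nonneg (inv_nonneg.mpr (Real.sqrt_nonneg _)) k
  exact mul_le_mul (mul_le_mul_of_nonneg_right (le_max_right _ _) hθk) hE' (Real.exp_pos _).le (mul_nonneg hC₄pos.le hθk)

/-- **THE TOWER LIMIT OF `(Q_k𝒢_kQ_k*)⁻¹` IN KERNEL CURRENCY, `U = 1`, `a = 1`, CUBIC UNIT TORI — UNCONDITIONAL**: `∃ δ₅ > 0` (d), `∀ L ≥ 2 ∃ C₅ > 0`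
(d, L), on every cubic unit torus a matrix `d_∞` on the unit bonds with, for all `i, i′` and every `k`: `(c_{L^k})⁻¹(i,i′) → d_∞(i,i′)`,
`‖(c_{L^k})⁻¹(i,i′) − d_∞(i,i′)‖ ≤ C₅·(1∕√L)^k·e^{−δ₅|…|}`, `‖d_∞(i,i′)‖ ≤ C₅·e^{−δ₅|…|}`; `C₅ = 2C₄∕(1 − 1∕√L)`.  By `tendsto_nhds_unique` this `d_∞`
coincides entrywise with leaf-04's sup-currency limit `d_∞ = c_∞⁻¹` (`AveragedPropagatorInverseTowerCubic`). [folklore] -/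
theorem tendsto_covOp_inv_tower_decay_cubic :
    ∃ δ₅ : ℝ, 0 < δ₅ ∧ ∀ (L : ℕ) [NeZero L], 2 ≤ L → ∃ C₅ : ℝ, 0 < C₅ ∧
      ∀ (N₀ : ℕ) [NeZero N₀],
        ∃ dinf : Matrix (Tor (fun _ : Fin (d + 1) => N₀) × Fin (d + 1)) (Tor (fun _ : Fin (d + 1) => N₀) × Fin (d + 1)) ℂ,
          ∀ (i i' : Tor (fun _ : Fin (d + 1) => N₀) × Fin (d + 1)),
            Tendsto (fun k : ℕ => (covOp (L ^ k) (fun _ : Fin (d + 1) => N₀) 1)⁻¹ i i') atTop (nhds (dinf i i')) ∧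
            (∀ k : ℕ, ‖(covOp (L ^ k) (fun _ : Fin (d + 1) => N₀) 1)⁻¹ i i' - dinf i i'‖
                ≤ C₅ * ((Real.sqrt L)⁻¹) ^ k * Real.exp (-(δ₅ * torusSupNorm (fun _ : Fin (d + 1) => N₀)
                    (rep (fun _ : Fin (d + 1) => N₀) i.1 - rep (fun _ : Fin (d + 1) => N₀) i'.1)))) ∧
            ‖dinf i i'‖ ≤ C₅ * Real.exp (-(δ₅ * torusSupNorm (fun _ : Fin (d + 1) => N₀)
                (rep (fun _ : Fin (d + 1) => N₀) i.1 - rep (fun _ : Fin (d + 1) => N₀) i'.1))) := by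
  obtain ⟨δ₅, hδ₅, hall⟩ := convC_shape_covOp_inv_tower_decay_cubic d
  refine ⟨δ₅, hδ₅, fun L _ hL2 => ?_⟩
  obtain ⟨C₄, hC₄, h⟩ := hall L hL2
  have hL1 : (1 : ℝ) < L := by exact_mod_cast hL2
  set θ : ℝ := (Real.sqrt L)⁻¹ with hθ
  have hsq : 1 < Real.sqrt L := by
    rw [show (1 : ℝ) = Real.sqrt 1 from Real.sqrt_one.symm]
    exact Real.sqrt_lt_sqrt zero_le_one hL1
  have hθ0 : 0 ≤ θ := inv_nonneg.mpr (Real.sqrt_nonneg _)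
  have hθ1 : θ < 1 := inv_lt_one_of_one_lt₀ hsq
  have h1θ : 0 < 1 - θ := by linarith
  have hθle : (1 : ℝ) ≤ 1 / (1 - θ) := by rw [le_div_iff₀ h1θ]; linarith
  refine ⟨2 * C₄ / (1 - θ), by positivity, fun N₀ _ => ?_⟩
  have key : ∀ i i' : Tor (fun _ : Fin (d + 1) => N₀) × Fin (d + 1), ∃ s : ℂ,
      Tendsto (fun k : ℕ => (covOp (L ^ k) (fun _ : Fin (d + 1) => N₀) 1)⁻¹ i i') atTop (nhds s) ∧
      (∀ k : ℕ, ‖(covOp (L ^ k) (fun _ : Fin (d + 1) => N₀) 1)⁻¹ i i' - s‖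
          ≤ 2 * C₄ / (1 - θ) * θ ^ k * Real.exp (-(δ₅ * torusSupNorm (fun _ : Fin (d + 1) => N₀)
              (rep (fun _ : Fin (d + 1) => N₀) i.1 - rep (fun _ : Fin (d + 1) => N₀) i'.1)))) ∧
      ‖s‖ ≤ 2 * C₄ / (1 - θ) * Real.exp (-(δ₅ * torusSupNorm (fun _ : Fin (d + 1) => N₀)
          (rep (fun _ : Fin (d + 1) => N₀) i.1 - rep (fun _ : Fin (d + 1) => N₀) i'.1))) := by
    intro i i'
    set w := Real.exp (-(δ₅ * torusSupNorm (fun _ : Fin (d + 1) => N₀)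
      (rep (fun _ : Fin (d + 1) => N₀) i.1 - rep (fun _ : Fin (d + 1) => N₀) i'.1))) with hw
    have hw0 : 0 < w := Real.exp_pos _
    have hstep : ∀ k : ℕ, ‖(covOp (L ^ (k + 1)) (fun _ : Fin (d + 1) => N₀) 1)⁻¹ i i' - (covOp (L ^ k) (fun _ : Fin (d + 1) => N₀) 1)⁻¹ i i'‖
        ≤ C₄ * θ ^ k * w := fun k => by
      have h2 := (h N₀ k i i').2
      rwa [Matrix.sub_apply] at h2
    obtain ⟨s, hs, htail, hs0⟩ :=
      exists_tower_limit (E := ℂ) (fun n _ => (covOp n (fun _ : Fin (d + 1) => N₀) 1)⁻¹ i i') hθ1 L hstep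
    have hc1 : ‖(covOp 1 (fun _ : Fin (d + 1) => N₀) 1)⁻¹ i i'‖ ≤ C₄ * w := by
      have := (h N₀ 0 i i').1
      rwa [level_congr (fun n _ => (covOp n (fun _ : Fin (d + 1) => N₀) 1)⁻¹ i i') (pow_zero L)] at this
    refine ⟨s, hs, fun k => (htail k).trans ?_, hs0.trans ?_⟩
    · have hθk : 0 ≤ θ ^ k := pow_nonneg hθ0 k
      have : C₄ / (1 - θ) ≤ 2 * C₄ / (1 - θ) := by rw [div_le_div_iff_of_pos_right h1θ]; linarith
      exact mul_le_mul_of_nonneg_right (mul_le_mul_of_nonneg_right this hθk) hw0.le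
    · have hup : C₄ * w ≤ C₄ / (1 - θ) * w := by
        have := mul_le_mul_of_nonneg_left hθle (mul_nonneg hC₄.le hw0.le)
        calc C₄ * w = C₄ * w * 1 := by ring
          _ ≤ C₄ * w * (1 / (1 - θ)) := this
          _ = C₄ / (1 - θ) * w := by ring
      calc ‖(covOp 1 (fun _ : Fin (d + 1) => N₀) 1)⁻¹ i i'‖ + C₄ / (1 - θ) * w ≤ C₄ / (1 - θ) * w + C₄ / (1 - θ) * w :=
            add_le_add (hc1.trans hup) le_rfl
        _ = 2 * C₄ / (1 - θ) * w := by ring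
  choose dinf hc using key
  exact ⟨Matrix.of fun i i' => dinf i i', fun i i' => hc i i'⟩

/-! ## §2 The same two clauses for NE2's effective operators `Δ_K^{(L^k)} = (c_{L^k}(1))⁻¹ − 1` -/

variable {d} in
/-- re-indexing `DeltaK` along an equality of levels (its `NeZero` instance and its `1 ≤ n` argument are propositions). [folklore] -/
theorem DeltaK_level_congr {M : Fin (d + 1) → ℕ} [∀ μ, NeZero (M μ)] {n m : ℕ} [NeZero n] [NeZero m] (h : n = m)
    (hn : 1 ≤ n) (hm : 1 ≤ m) {a : ℝ} (ha : 0 < a) : DeltaK n hn M a ha = DeltaK m hm M a ha := by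
  subst h; rfl

/-- the identity kernel is dominated by every decay profile from the diagonal (`‖δ_{ii′}‖ ≤ e^{−δ|rep i₁ − rep i′₁|}`). [folklore] -/
theorem norm_one_apply_le_exp (N₀ : ℕ) [NeZero N₀] (δ : ℝ) (i i' : Tor (fun _ : Fin (d + 1) => N₀) × Fin (d + 1)) :
    ‖(1 : Matrix (Tor (fun _ : Fin (d + 1) => N₀) × Fin (d + 1)) (Tor (fun _ : Fin (d + 1) => N₀) × Fin (d + 1)) ℂ) i i'‖
      ≤ Real.exp (-(δ * torusSupNorm (fun _ : Fin (d + 1) => N₀)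
          (rep (fun _ : Fin (d + 1) => N₀) i.1 - rep (fun _ : Fin (d + 1) => N₀) i'.1))) := by
  by_cases h : i = i'
  · subst h
    rw [Matrix.one_apply_eq, norm_one, tsn_self, mul_zero, neg_zero, Real.exp_zero]
  · rw [Matrix.one_apply_ne h, norm_zero]
    positivity

/-- **THE (CONV-C) TWO-CLAUSE SHAPE FOR NE2's `Δ_K^{(L^k)}` IN KERNEL CURRENCY ON CUBIC UNIT TORI, `a = 1` — UNCONDITIONAL**: `∃ δ₅ > 0` (d),
`∀ L ≥ 2 ∃ C₄ > 0` (d, L), for every `N₀ ≥ 1`, every level `k` (with the level witnesses `1 ≤ L^k`, `1 ≤ L^{k+1}` that `DeltaK` displays) and all unit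
bonds `i, i′`: `‖Δ_K^{(L^k)}(i,i′)‖ ≤ C₄·e^{−δ₅|rep i₁ − rep i′₁|_T}` ∧ `‖(Δ_K^{(L^{k+1})} − Δ_K^{(L^k)})(i,i′)‖ ≤ C₄·(1∕√L)^k·e^{−δ₅|rep i₁ − rep i′₁|_T}`
— §1 plus `Δ_K = c⁻¹ − 1` (`BalabanHardMinimizer.DeltaK`, `covOp_eq_covB`): the differences ARE the inverse's, the kernel is the inverse's minus `δ_{ii′}`.
[folklore] -/
theorem convC_shape_DeltaK_tower_decay_cubic :
    ∃ δ₅ : ℝ, 0 < δ₅ ∧ ∀ (L : ℕ) [NeZero L], 2 ≤ L → ∃ C₄ : ℝ, 0 < C₄ ∧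
      ∀ (N₀ : ℕ) [NeZero N₀] (k : ℕ) (hk : 1 ≤ L ^ k) (hk1 : 1 ≤ L ^ (k + 1)) (i i' : Tor (fun _ : Fin (d + 1) => N₀) × Fin (d + 1)),
        ‖DeltaK (L ^ k) hk (fun _ : Fin (d + 1) => N₀) 1 one_pos i i'‖
            ≤ C₄ * Real.exp (-(δ₅ * torusSupNorm (fun _ : Fin (d + 1) => N₀)
                (rep (fun _ : Fin (d + 1) => N₀) i.1 - rep (fun _ : Fin (d + 1) => N₀) i'.1))) ∧
        ‖(DeltaK (L ^ (k + 1)) hk1 (fun _ : Fin (d + 1) => N₀) 1 one_pos - DeltaK (L ^ k) hk (fun _ : Fin (d + 1) => N₀) 1 one_pos) i i'‖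
            ≤ C₄ * ((Real.sqrt L)⁻¹) ^ k * Real.exp (-(δ₅ * torusSupNorm (fun _ : Fin (d + 1) => N₀)
                (rep (fun _ : Fin (d + 1) => N₀) i.1 - rep (fun _ : Fin (d + 1) => N₀) i'.1))) := by
  obtain ⟨δ₅, hδ₅, hall⟩ := convC_shape_covOp_inv_tower_decay_cubic d
  refine ⟨δ₅, hδ₅, fun L _ hL2 => ?_⟩
  obtain ⟨C₄, hC₄, h⟩ := hall L hL2
  refine ⟨C₄ + 1, by positivity, fun N₀ _ k hk hk1 i i' => ?_⟩
  obtain ⟨h1, h2⟩ := h N₀ k i i'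
  have hE := Real.exp_pos (-(δ₅ * torusSupNorm (fun _ : Fin (d + 1) => N₀)
    (rep (fun _ : Fin (d + 1) => N₀) i.1 - rep (fun _ : Fin (d + 1) => N₀) i'.1)))
  have hθk : 0 ≤ ((Real.sqrt L)⁻¹) ^ k := pow_nonneg (inv_nonneg.mpr (Real.sqrt_nonneg _)) k
  constructor
  · -- the kernel: `Δ_K = c⁻¹ − 1•1`
    rw [DeltaK, ← covOp_eq_covB (L ^ k) hk (fun _ : Fin (d + 1) => N₀) 1 one_pos, Matrix.sub_apply, Matrix.smul_apply,
      Complex.ofReal_one, one_smul]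
    have hI := norm_one_apply_le_exp d N₀ δ₅ i i'
    calc _ ≤ ‖(covOp (L ^ k) (fun _ : Fin (d + 1) => N₀) 1)⁻¹ i i'‖
          + ‖(1 : Matrix (Tor (fun _ : Fin (d + 1) => N₀) × Fin (d + 1)) (Tor (fun _ : Fin (d + 1) => N₀) × Fin (d + 1)) ℂ) i i'‖ :=
        norm_sub_le _ _
      _ ≤ _ := add_le_add h1 hI
      _ = _ := by ring
  · -- the differences are the inverse's
    rw [DeltaK_level_congr (pow_succ' L k) hk1 (Nat.one_le_iff_ne_zero.mpr (NeZero.ne (L * L ^ k))) one_pos,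
      DeltaK_succ_sub_eq (L ^ k) L (fun _ : Fin (d + 1) => N₀) one_pos hk,
      ← level_congr (fun n _ => (covOp n (fun _ : Fin (d + 1) => N₀) 1)⁻¹) (pow_succ' L k)]
    exact h2.trans (mul_le_mul_of_nonneg_right (mul_le_mul_of_nonneg_right (by linarith) hθk) hE.le)

end Summit.QuantumFields.BalabanUV.Beta.GAN24.AveragedPropagatorInverseTowerDecayCubic

end
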